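import Literature.NumberTheory.LFunctions.DirichletLAFEKernelBounds
import Literature.NumberTheory.LFunctions.DirichletLSmoothedAFEIdentity
import HarnessLib

/-!
# The smooth approximate functional equation for primitive Dirichlet `L`-functions, II:
# the term-by-term expansion `I(ψ, z) = 2π q^{z/2} γ_ψ(z) Σ_n ψ(n) V(w, n√(π/q)) n^{-z}`

Topic `Literature/NumberTheory/LFunctions`. Everything here is PROVED (no definitions, no named facts).

Continuation of `DirichletLSmoothedAFEIdentity.lean` (`2π Λ̃(χ,s) = I(χ,s) + ε(χ) I(χ̄,1−s)`,
`I(ψ,z) = ∫ Λ̃(ψ,z+u) e^{u²} u^{-1} dv`, `u = ¾ + iv`) and `DirichletLAFEKernelBounds.lean` (the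
kernel `V(w,y) = (1/2π)∫ Γ(w+u/2)/Γ(w) · e^{u²} y^{-u} u^{-1} dv` and its bounds). Here, for a
non-trivial character `ψ` mod `q ≠ 1` with gamma factor `Γ_ℝ(· + κ)` and `Re z = ½`, we expand
`Λ̃(ψ, z+u) = q^{(z+u)/2} γ_ψ(z+u) Σ_n ψ(n) n^{-z-u}` (`Re(z+u) = 5/4 > 1`) and integrate term by
term (absolute convergence: Gaussian majorant times `Σ n^{-5/4}`):

* `cpow_scaling_identity` — `q^{(z+u)/2} π^{-(z+u+κ)/2} n^{-(z+u)} = q^{z/2} π^{-(z+κ)/2} n^{-z} · y_n^{-u}`,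
  `y_n = n √(π/q)`;
* `afe_series_expansion` — **`I(ψ,z) = 2π q^{z/2} γ_ψ(z) · L((ψ(n) V(w, y_n))_n, z)`**,
  `w = (z+κ)/2` ([IwaniecKowalski2004, Theorem 5.3, (5.13)–(5.14)] for degree one).

## References
* [IwaniecKowalski2004] H. Iwaniec, E. Kowalski, *Analytic Number Theory*, AMS Coll. Publ. 53
  (2004), §5.2, Theorem 5.3, (5.13)–(5.14).
-/

noncomputable section

open Complex MeasureTheory Real Set Filter DirichletCharacter
open scoped Topology

namespace Literature.NumberTheory.LFunctions.DirichletConvexity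

open Literature.NumberTheory.LFunctions.SelbergDirichlet (gammaFactor_ne_zero_of_re_pos)
open Literature.NumberTheory.LFunctions.ConreyIwaniec2002.AFEKernel (norm_lineF_le integrable_lineF
  continuous_lineF)

variable {q : ℕ} [NeZero q]

/-! ### §1. Powers of positive reals -/

omit [NeZero q] in
/-- `r^w = exp(w log r)` for a positive real base. [folklore] -/
private theorem ofReal_cpow_eq_exp {r : ℝ} (hr : 0 < r) (w : ℂ) :
    (r : ℂ) ^ w = cexp (w * (Real.log r : ℂ)) := by
  rw [Complex.cpow_def_of_ne_zero (by exact_mod_cast hr.ne'), Complex.ofReal_log hr.le, mul_comm]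

omit [NeZero q] in
/-- **The scaling identity**: for `n ≥ 1`, `q ≥ 1`,
`q^{(z+u)/2} π^{-(z+u+κ)/2} (n^{z+u})^{-1} = (q^{z/2} π^{-(z+κ)/2} (n^z)^{-1}) · y_n^{-u}`,
`y_n = n √(π/q)` (all bases positive reals, so everything is `exp` of linear forms in the logs).
[cite: IwaniecKowalski2004, Theorem 5.3 (proof)] -/
theorem cpow_scaling_identity (hq : 0 < q) {n : ℕ} (hn : n ≠ 0) (κ : ℝ) (z u : ℂ) :
    (q : ℂ) ^ ((z + u) / 2) * (π : ℂ) ^ (-(z + u + κ) / 2) * ((n : ℂ) ^ (z + u))⁻¹ =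
      ((q : ℂ) ^ (z / 2) * (π : ℂ) ^ (-(z + κ) / 2) * ((n : ℂ) ^ z)⁻¹) *
        (((n : ℝ) * Real.sqrt (π / q) : ℝ) : ℂ) ^ (-u) := by
  have hqR : (0 : ℝ) < q := by exact_mod_cast hq
  have hnR : (0 : ℝ) < n := by exact_mod_cast Nat.pos_of_ne_zero hn
  have hπq : 0 < π / q := div_pos Real.pi_pos hqR
  have hy : 0 < (n : ℝ) * Real.sqrt (π / q) := mul_pos hnR (Real.sqrt_pos.2 hπq)
  have hlogy : Real.log ((n : ℝ) * Real.sqrt (π / q)) =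
      Real.log n + (Real.log π - Real.log q) / 2 := by
    rw [Real.log_mul hnR.ne' (Real.sqrt_pos.2 hπq).ne', Real.log_sqrt hπq.le,
      Real.log_div Real.pi_pos.ne' hqR.ne']
  rw [show ((q : ℂ)) = ((q : ℝ) : ℂ) by norm_cast, show ((n : ℂ)) = ((n : ℝ) : ℂ) by norm_cast,
    ofReal_cpow_eq_exp hqR, ofReal_cpow_eq_exp Real.pi_pos, ofReal_cpow_eq_exp hnR,
    ofReal_cpow_eq_exp hqR, ofReal_cpow_eq_exp Real.pi_pos, ofReal_cpow_eq_exp hnR,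
    ofReal_cpow_eq_exp hy, hlogy, ← Complex.exp_neg, ← Complex.exp_neg, ← Complex.exp_add,
    ← Complex.exp_add, ← Complex.exp_add, ← Complex.exp_add, ← Complex.exp_add]
  congr 1
  push_cast
  ring

/-! ### §2. The summands -/

omit [NeZero q] in
/-- **The summand identity**: for `n ≥ 1`, with `γ_ψ(w) = Γ_ℝ(w+κ) = π^{-(w+κ)/2}Γ((w+κ)/2)`,
`w₀ = (z+κ)/2`, `y_n = n√(π/q)`:
`q^{(z+u)/2} γ_ψ(z+u) e^{u²} u^{-1} · ψ(n)(n^{z+u})^{-1}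
 = (q^{z/2} γ_ψ(z) ψ(n) (n^z)^{-1}) · (Γ(w₀+u/2)/Γ(w₀) · e^{u²} y_n^{-u} / u)`.
[cite: IwaniecKowalski2004, Theorem 5.3 (proof)] -/
theorem summand_identity (hq : 0 < q) (ψ : DirichletCharacter ℂ q) {κ : ℕ}
    (hγ : ∀ w, gammaFactor ψ w = Gammaℝ (w + κ)) {z : ℂ} (hz : 0 < (z + κ).re) {n : ℕ}
    (hn : n ≠ 0) (u : ℂ) :
    (q : ℂ) ^ ((z + u) / 2) * gammaFactor ψ (z + u) * cexp (u ^ 2) / u *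
        (ψ n / (n : ℂ) ^ (z + u)) =
      ((q : ℂ) ^ (z / 2) * gammaFactor ψ z * (ψ n / (n : ℂ) ^ z)) *
        (Complex.Gamma ((z + κ) / 2 + u / 2) / Complex.Gamma ((z + κ) / 2) * cexp (u ^ 2) *
          ((((n : ℝ) * Real.sqrt (π / q) : ℝ) : ℂ)) ^ (-u) / u) := by
  have hz' : 0 < z.re + κ := by simpa using hz
  have hΓ : Complex.Gamma ((z + κ) / 2) ≠ 0 :=
    Complex.Gamma_ne_zero_of_re_pos (by simp; linarith)
  rw [hγ (z + u), hγ z, Gammaℝ_def, Gammaℝ_def]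
  have e1 : (z + u + (κ : ℂ)) / 2 = (z + κ) / 2 + u / 2 := by ring
  rw [e1]
  have key := cpow_scaling_identity hq hn κ z u
  rw [show (-(z + u + (κ : ℂ)) / 2) = (-(z + u + (κ : ℝ)) / 2 : ℂ) by push_cast; ring,
    show (-(z + (κ : ℂ)) / 2) = (-(z + (κ : ℝ)) / 2 : ℂ) by push_cast; ring]
  -- rewrite divisions as multiplications by inverses and use `key`
  rw [div_eq_mul_inv (ψ n), div_eq_mul_inv (ψ n)]
  calc (q : ℂ) ^ ((z + u) / 2) * ((π : ℂ) ^ (-(z + u + (κ : ℝ)) / 2) *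
        Complex.Gamma ((z + κ) / 2 + u / 2)) * cexp (u ^ 2) / u * (ψ n * ((n : ℂ) ^ (z + u))⁻¹)
      = ((q : ℂ) ^ ((z + u) / 2) * (π : ℂ) ^ (-(z + u + (κ : ℝ)) / 2) * ((n : ℂ) ^ (z + u))⁻¹) *
          (ψ n * Complex.Gamma ((z + κ) / 2 + u / 2) * cexp (u ^ 2) / u) := by ring
    _ = (((q : ℂ) ^ (z / 2) * (π : ℂ) ^ (-(z + (κ : ℝ)) / 2) * ((n : ℂ) ^ z)⁻¹) *
          (((n : ℝ) * Real.sqrt (π / q) : ℝ) : ℂ) ^ (-u)) *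
          (ψ n * Complex.Gamma ((z + κ) / 2 + u / 2) * cexp (u ^ 2) / u) := by rw [key]
    _ = _ := by
        field_simp

/-! ### §3. The term-by-term expansion -/

omit [NeZero q] in
/-- `∫ e^{-v²/2} dv = √(2π)`. [folklore] -/
private theorem integral_exp_neg_sq_half' : ∫ v : ℝ, Real.exp (-(v ^ 2 / 2)) = Real.sqrt (2 * π) := by
  have h := integral_gaussian (1 / 2)
  have e : (fun v : ℝ ↦ Real.exp (-(v ^ 2 / 2))) = fun v : ℝ ↦ Real.exp (-(1 / 2) * v ^ 2) := by
    funext v; congr 1; ring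
  rw [e, h]; congr 1; field_simp

omit [NeZero q] in
/-- The half-Gaussian is integrable. [folklore] -/
private theorem integrable_exp_neg_sq_half' : Integrable fun v : ℝ ↦ Real.exp (-(v ^ 2 / 2)) := by
  have h := integrable_exp_neg_mul_sq (b := 1 / 2) (by norm_num)
  refine h.congr (Filter.Eventually.of_forall fun v ↦ ?_)
  simp only; congr 1; ring

/-- **TERM-BY-TERM EXPANSION OF `I(ψ, z)`.** For `ψ` mod `q ≠ 1` with gamma factor
`Γ_ℝ(· + κ)` (`κ ∈ {0,1}`) and `Re z = ½`:
`∫ Λ̃(ψ,z+u) e^{u²} u^{-1} dv = 2π q^{z/2} γ_ψ(z) · L((ψ(n) V(w₀, y_n))_n, z)`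
(`u = ¾+iv`, `w₀ = (z+κ)/2`, `y_n = n√(π/q)`, `V(w,y) = (1/2π)∫ Γ(w+u/2)/Γ(w) e^{u²} y^{-u} u^{-1} dv`),
the series converging absolutely. [cite: IwaniecKowalski2004, Theorem 5.3, (5.13)–(5.14)] -/
theorem afe_series_expansion (hq : 1 < q) (ψ : DirichletCharacter ℂ q) {κ : ℕ}
    (hκ : κ ≤ 1) (hγ : ∀ w, gammaFactor ψ w = Gammaℝ (w + κ)) {z : ℂ} (hz : z.re = 1 / 2) :
    (∫ v : ℝ, (fun w : ℂ => (q : ℂ) ^ ((z + w) / 2) * completedLFunction ψ (z + w))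
        (((3 / 4 : ℝ) : ℂ) + v * I) * cexp ((((3 / 4 : ℝ) : ℂ) + v * I) ^ 2) *
        (((1 : ℝ) : ℂ)) ^ (-(((3 / 4 : ℝ) : ℂ) + v * I)) / (((3 / 4 : ℝ) : ℂ) + v * I)) =
      2 * π * ((q : ℂ) ^ (z / 2) * gammaFactor ψ z *
        LSeries (fun n : ℕ => ψ n * ((1 / (2 * π) : ℂ) * ∫ v : ℝ,
          (fun u : ℂ => Complex.Gamma ((z + κ) / 2 + u / 2) / Complex.Gamma ((z + κ) / 2))
            (((3 / 4 : ℝ) : ℂ) + v * I) * cexp ((((3 / 4 : ℝ) : ℂ) + v * I) ^ 2) *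
            ((((n : ℝ) * Real.sqrt (π / q) : ℝ) : ℂ)) ^ (-(((3 / 4 : ℝ) : ℂ) + v * I)) /
            (((3 / 4 : ℝ) : ℂ) + v * I))) z) := by
  have hq1 : q ≠ 1 := by omega
  have hqpos : 0 < q := by omega
  have hqR : (0 : ℝ) < q := by exact_mod_cast hqpos
  have hκR : (κ : ℝ) ≤ 1 := by exact_mod_cast hκ
  have hκ0 : (0 : ℝ) ≤ κ := Nat.cast_nonneg κ
  -- the half-argument `w₀ = (z+κ)/2`
  set w₀ : ℂ := (z + κ) / 2 with hw₀
  have hw₀re : w₀.re = (z.re + κ) / 2 := by simp [hw₀]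
  have hw₁ : 1 / 4 ≤ w₀.re := by rw [hw₀re, hz]; linarith
  have hw₂ : w₀.re ≤ 3 / 4 := by rw [hw₀re, hz]; linarith
  have hw₀pos : 0 < w₀.re := by linarith
  have hzκ : 0 < (z + (κ : ℂ)).re := by simp [hz]; linarith
  set h : ℂ → ℂ := fun u : ℂ => Complex.Gamma (w₀ + u / 2) / Complex.Gamma w₀ with hhdef
  -- Stirling class of `h` on the line `Re u = 3/4`
  obtain ⟨C, hC, hh⟩ := exists_norm_hfun_le
  have hline : ∀ v : ℝ, ‖h (((3 / 4 : ℝ) : ℂ) + v * I)‖ ≤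
      C * ‖w₀‖ ^ ((3 / 4 : ℝ) / 2) * (1 + |v|) ^ 7 * Real.exp (π * |v| / 2) := by
    intro v
    have := hh w₀ hw₁ hw₂ (((3 / 4 : ℝ) : ℂ) + v * I) (by simp; norm_num) (by simp; norm_num)
    simpa [hhdef] using this
  have hcont : Continuous fun v : ℝ => h (((3 / 4 : ℝ) : ℂ) + v * I) := by
    have hd := differentiableOn_hfun (w := w₀) hw₁ (a := -1 / 4) (b := 3 / 4) (by norm_num)
    have hl : Continuous fun v : ℝ => ((3 / 4 : ℝ) : ℂ) + v * I := by fun_prop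
    exact hd.continuousOn.comp_continuous hl fun v => by simp; norm_num
  -- the sequence `y_n`
  have hy : ∀ n : ℕ, n ≠ 0 → 0 < (n : ℝ) * Real.sqrt (π / q) := fun n hn =>
    mul_pos (by exact_mod_cast Nat.pos_of_ne_zero hn) (Real.sqrt_pos.2 (div_pos Real.pi_pos hqR))
  -- the summands
  set c : ℕ → ℂ := fun n => (q : ℂ) ^ (z / 2) * gammaFactor ψ z * LSeries.term (fun n : ℕ => ψ n) z n
    with hc
  set Fl : ℕ → ℝ → ℂ := fun n v => h (((3 / 4 : ℝ) : ℂ) + v * I) *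
      cexp ((((3 / 4 : ℝ) : ℂ) + v * I) ^ 2) *
      ((((n : ℝ) * Real.sqrt (π / q) : ℝ) : ℂ)) ^ (-(((3 / 4 : ℝ) : ℂ) + v * I)) /
      (((3 / 4 : ℝ) : ℂ) + v * I) with hFl
  set F : ℕ → ℝ → ℂ := fun n v => c n * Fl n v with hF
  have hc0 : c 0 = 0 := by simp [hc, LSeries.term_zero]
  have hF0 : F 0 = fun _ => 0 := by funext v; simp [hF, hc0]
  -- integrability of each summand
  have hFint : ∀ n, Integrable (F n) := by
    intro n
    rcases eq_or_ne n 0 with rfl | hn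
    · rw [hF0]; exact integrable_zero _ _ _
    · have hi := integrable_lineF (h := h) (c := 3 / 4) (k := 1) (n := 7)
        (M := C * ‖w₀‖ ^ ((3 / 4 : ℝ) / 2)) (hy n hn) (Or.inr (by norm_num)) hcont hline
      simp only [pow_one] at hi
      exact hi.const_mul (c n)
  -- the norm of each summand's integral: Gaussian majorant
  set B : ℝ := C * ‖w₀‖ ^ ((3 / 4 : ℝ) / 2) * Real.exp ((3 / 4 : ℝ) ^ 2 + ((7 : ℝ) + 2) ^ 2 / 2) /
    |(3 / 4 : ℝ)| ^ 1 * Real.sqrt (2 * π) with hB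
  have hB0 : 0 ≤ B := by rw [hB]; positivity
  have hnormint : ∀ n : ℕ, n ≠ 0 →
      ∫ v : ℝ, ‖F n v‖ ≤ ‖c n‖ * (B * ((n : ℝ) * Real.sqrt (π / q)) ^ (-(3 / 4 : ℝ))) := by
    intro n hn
    have hpt : ∀ v : ℝ, ‖F n v‖ ≤ ‖c n‖ * (C * ‖w₀‖ ^ ((3 / 4 : ℝ) / 2) *
        Real.exp ((3 / 4 : ℝ) ^ 2 + ((7 : ℕ) + 2 : ℝ) ^ 2 / 2) *
        ((n : ℝ) * Real.sqrt (π / q)) ^ (-(3 / 4 : ℝ)) / |(3 / 4 : ℝ)| ^ 1 * Real.exp (-(v ^ 2 / 2))) := by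
      intro v
      simp only [hF]
      rw [norm_mul]
      refine mul_le_mul_of_nonneg_left ?_ (norm_nonneg _)
      have := norm_lineF_le (h := h) (c := 3 / 4) (k := 1) (n := 7)
        (M := C * ‖w₀‖ ^ ((3 / 4 : ℝ) / 2)) (hy n hn) (Or.inr (by norm_num)) hline v
      simpa [hFl, pow_one] using this
    have hgi : Integrable fun v : ℝ => ‖c n‖ * (C * ‖w₀‖ ^ ((3 / 4 : ℝ) / 2) *
        Real.exp ((3 / 4 : ℝ) ^ 2 + ((7 : ℕ) + 2 : ℝ) ^ 2 / 2) *
        ((n : ℝ) * Real.sqrt (π / q)) ^ (-(3 / 4 : ℝ)) / |(3 / 4 : ℝ)| ^ 1 * Real.exp (-(v ^ 2 / 2))) :=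
      (integrable_exp_neg_sq_half'.const_mul _).const_mul _
    calc ∫ v : ℝ, ‖F n v‖ ≤ ∫ v : ℝ, ‖c n‖ * (C * ‖w₀‖ ^ ((3 / 4 : ℝ) / 2) *
          Real.exp ((3 / 4 : ℝ) ^ 2 + ((7 : ℕ) + 2 : ℝ) ^ 2 / 2) *
          ((n : ℝ) * Real.sqrt (π / q)) ^ (-(3 / 4 : ℝ)) / |(3 / 4 : ℝ)| ^ 1 * Real.exp (-(v ^ 2 / 2))) :=
          integral_mono (hFint n).norm hgi hpt
      _ = ‖c n‖ * (B * ((n : ℝ) * Real.sqrt (π / q)) ^ (-(3 / 4 : ℝ))) := by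
          rw [integral_const_mul, integral_const_mul, integral_exp_neg_sq_half', hB]
          push_cast; ring
  -- `‖c n‖ ≤ ‖q^{z/2} γ(z)‖ n^{-1/2}` and summability of `Σ ∫‖F n‖`
  have hcn : ∀ n : ℕ, n ≠ 0 → ‖c n‖ ≤ ‖(q : ℂ) ^ (z / 2) * gammaFactor ψ z‖ * (n : ℝ) ^ (-(1 / 2 : ℝ)) := by
    intro n hn
    have hn0 : (0 : ℝ) < n := by exact_mod_cast Nat.pos_of_ne_zero hn
    simp only [hc]
    rw [norm_mul, LSeries.norm_term_eq, if_neg hn, hz, Real.rpow_neg hn0.le, div_eq_mul_inv]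
    gcongr
    calc ‖ψ n‖ * ((n : ℝ) ^ (1 / 2 : ℝ))⁻¹ ≤ 1 * ((n : ℝ) ^ (1 / 2 : ℝ))⁻¹ :=
          mul_le_mul_of_nonneg_right (ψ.norm_le_one _) (by positivity)
      _ = _ := one_mul _
  have hsum : Summable fun n => ∫ v : ℝ, ‖F n v‖ := by
    set D : ℝ := ‖(q : ℂ) ^ (z / 2) * gammaFactor ψ z‖ * (B * (Real.sqrt (π / q)) ^ (-(3 / 4 : ℝ)))
      with hD
    have hg : Summable fun n : ℕ => D * (n : ℝ) ^ (-(5 / 4 : ℝ)) :=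
      (Real.summable_nat_rpow.2 (by norm_num)).mul_left D
    refine Summable.of_nonneg_of_le (fun n => integral_nonneg fun v => norm_nonneg _) (fun n => ?_) hg
    rcases eq_or_ne n 0 with rfl | hn
    · simp [hF0]
    have hn0 : (0 : ℝ) < n := by exact_mod_cast Nat.pos_of_ne_zero hn
    have hsq : 0 ≤ Real.sqrt (π / q) := Real.sqrt_nonneg _
    calc ∫ v : ℝ, ‖F n v‖ ≤ ‖c n‖ * (B * ((n : ℝ) * Real.sqrt (π / q)) ^ (-(3 / 4 : ℝ))) := hnormint n hn
      _ ≤ (‖(q : ℂ) ^ (z / 2) * gammaFactor ψ z‖ * (n : ℝ) ^ (-(1 / 2 : ℝ))) *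
            (B * ((n : ℝ) * Real.sqrt (π / q)) ^ (-(3 / 4 : ℝ))) :=
          mul_le_mul_of_nonneg_right (hcn n hn) (by positivity)
      _ = D * ((n : ℝ) ^ (-(1 / 2 : ℝ)) * (n : ℝ) ^ (-(3 / 4 : ℝ))) := by
          rw [hD, Real.mul_rpow hn0.le hsq]; ring
      _ = D * (n : ℝ) ^ (-(5 / 4 : ℝ)) := by rw [← Real.rpow_add hn0]; norm_num
  -- the integrand is the sum of the summands
  have hq0 : (q : ℂ) ≠ 0 := by exact_mod_cast hqpos.ne'
  have hpt : ∀ v : ℝ, (fun w : ℂ => (q : ℂ) ^ ((z + w) / 2) * completedLFunction ψ (z + w))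
        (((3 / 4 : ℝ) : ℂ) + v * I) * cexp ((((3 / 4 : ℝ) : ℂ) + v * I) ^ 2) *
        (((1 : ℝ) : ℂ)) ^ (-(((3 / 4 : ℝ) : ℂ) + v * I)) / (((3 / 4 : ℝ) : ℂ) + v * I) =
      ∑' n : ℕ, F n v := by
    intro v
    set u : ℂ := ((3 / 4 : ℝ) : ℂ) + v * I with hu
    have hure : u.re = 3 / 4 := by simp [hu]
    have hzu : 1 < (z + u).re := by simp [hz, hure]; norm_num
    have hzu0 : 0 < (z + u).re := by linarith
    have hΛ : completedLFunction ψ (z + u) = gammaFactor ψ (z + u) * LFunction ψ (z + u) := by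
      rw [LFunction_eq_completed_div_gammaFactor ψ (z + u) (Or.inr hq1)]
      field_simp [gammaFactor_ne_zero_of_re_pos ψ hzu0]
    have hL : LFunction ψ (z + u) = ∑' n : ℕ, LSeries.term (fun n : ℕ => ψ n) (z + u) n := by
      rw [LFunction_eq_LSeries ψ hzu]; rfl
    simp only
    have hre : (q : ℂ) ^ ((z + u) / 2) * completedLFunction ψ (z + u) * cexp (u ^ 2) *
        (((1 : ℝ) : ℂ)) ^ (-u) / u =
        ((q : ℂ) ^ ((z + u) / 2) * gammaFactor ψ (z + u) * cexp (u ^ 2) / u) *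
          ∑' n : ℕ, LSeries.term (fun n : ℕ => ψ n) (z + u) n := by
      rw [Complex.ofReal_one, one_cpow, mul_one, hΛ, hL]; ring
    rw [hre, ← tsum_mul_left]
    refine tsum_congr fun n => ?_
    rcases eq_or_ne n 0 with rfl | hn
    · simp [hF0, LSeries.term_zero]
    simp only [hF, hc, hFl]
    rw [LSeries.term_of_ne_zero hn, LSeries.term_of_ne_zero hn]
    have key := summand_identity hqpos ψ hγ hzκ hn u
    rw [← hw₀] at key
    rw [key]
  -- exchange sum and integral
  have hint : (∫ v : ℝ, (fun w : ℂ => (q : ℂ) ^ ((z + w) / 2) * completedLFunction ψ (z + w))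
        (((3 / 4 : ℝ) : ℂ) + v * I) * cexp ((((3 / 4 : ℝ) : ℂ) + v * I) ^ 2) *
        (((1 : ℝ) : ℂ)) ^ (-(((3 / 4 : ℝ) : ℂ) + v * I)) / (((3 / 4 : ℝ) : ℂ) + v * I)) =
      ∑' n : ℕ, ∫ v : ℝ, F n v := by
    rw [integral_tsum_of_summable_integral_norm hFint hsum]
    exact integral_congr_ae (Eventually.of_forall hpt)
  rw [hint]
  -- each `∫ F n = c n · (2π V n)`
  have hFn : ∀ n : ℕ, ∫ v : ℝ, F n v = c n * ∫ v : ℝ, Fl n v := by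
    intro n; simp only [hF]; exact integral_const_mul _ _
  simp_rw [hFn]
  rw [LSeries]
  have hπ : (π : ℂ) ≠ 0 := ofReal_ne_zero.2 Real.pi_pos.ne'
  have hrhs : ∀ n : ℕ, (∫ v : ℝ, h (((3 / 4 : ℝ) : ℂ) + v * I) *
        cexp ((((3 / 4 : ℝ) : ℂ) + v * I) ^ 2) *
        ((((n : ℝ) * Real.sqrt (π / q) : ℝ) : ℂ)) ^ (-(((3 / 4 : ℝ) : ℂ) + v * I)) /
        (((3 / 4 : ℝ) : ℂ) + v * I)) = ∫ v : ℝ, Fl n v := fun n => rfl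
  simp_rw [hrhs]
  rw [← tsum_mul_left, ← tsum_mul_left]
  refine tsum_congr fun n => ?_
  rcases eq_or_ne n 0 with rfl | hn
  · simp [hc0, LSeries.term_zero]
  simp only [hc]
  rw [LSeries.term_of_ne_zero hn, LSeries.term_of_ne_zero hn]
  generalize (∫ v : ℝ, Fl n v) = J
  field_simp

end Literature.NumberTheory.LFunctions.DirichletConvexity

end
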